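import Mathlib
import HarnessLib

/-!
# Hermitian determinantal representations of hyperbolic cubic surfaces (Hanselka–Kummer 2023, Cor. 12.10)

A NAMED FACT (D-0014, statement only), requested by route ValiantsHypothesis/PermanentalCones
(crux `HyperbolicVPShadow`, item `stmt-ValiantsHypothesis-8655`, lead c4 skeleton stub
`stub_hanselkaKummer_cor1210`): the `N = 3` layer of that crux reduces to the statement that the
cubic `det (x₀·1 + x₁A + x₂B + x₃C)` of a linear space of real `3 × 3` matrices with only real
eigenvalues has a *hermitian* determinantal representation, whence its closed nonnegative-spectrum
cone is a spectrahedron of size `6` (realification).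

* `HanselkaKummer2023_cor1210` — C. Hanselka, M. Kummer, *Positive Ulrich sheaves*, Canad. J. Math.
  76 (2024) 881–914 (published online 2023; arXiv:2008.00201, held text), **Corollary 12.10**
  (verbatim): "Every hyperbolic polynomial `h ∈ ℝ[x₀,x₁,x₂,x₃]` of degree three has a definite
  hermitian determinantal representation." The printed proof: for smooth `V(h)` by the positive
  Ulrich sheaf on the real del Pezzo surface (ibid. Thm. 12.9 with Prop. 9.1 — "originally due to
  Buckley and Košir", A. Buckley, T. Košir, *Determinantal representations of smooth cubic
  surfaces*, Geom. Dedicata 125 (2007) 115–140); "For the singular case note that by [Nuij] the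
  set of all hyperbolic polynomials is the closure of the smooth ones. Further by [Plaumann–Vinzant
  2013] the set of hyperbolic polynomials with a definite hermitian determinantal representation is
  closed."
  Printed definitions (ibid. §1): for `h ∈ ℝ[x₀,…,xₙ]_d` homogeneous, "there are … complex
  hermitian matrices `A₀, …, Aₙ` … such that `h = det (x₀A₀ + … + xₙAₙ)` and `e₀A₀ + … + eₙAₙ` is
  positive definite for some `e ∈ ℝⁿ⁺¹`. In this case, we say that `h` has a definite hermitian
  determinantal representation and it is a certificate that `h` is hyperbolic with respect to `e`
  in the sense that the univariate polynomial `h(te − v) ∈ ℝ[t]` has only real zeros for all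
  `v ∈ ℝⁿ⁺¹`"; and the normal form in which the representation is produced (ibid. §9, Prop. 9.1,
  `e = (1, 0, …, 0)`, "Assume `h(1,0,⋯,0) = 1`"): "`h^r = det (y·I − A)`" with `A` a hermitian
  matrix of linear forms in `x₁, …, xₙ` (here `r = 1`, `d·r = 3`).

## Rendering
* `p : MvPolynomial (Fin 4) ℝ` with `p.IsHomogeneous 3`; `e = ![1, 0, 0, 0]`;
  `MvPolynomial.eval ![1, 0, 0, 0] p = 1` (the normalisation of Prop. 9.1; for general `e` with
  `p(e) ≠ 0` one rescales and changes coordinates linearly — users derive that themselves, exactly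
  as `symmetric_pencil_of_laxConjecture` does for the tree's Lax fact).
* "`t ↦ p(w − te)` has only real zeros": as in `LewisParriloRamana2005_laxConjecture`, the
  univariate polynomial is `MvPolynomial.aeval (fun i => C (w i) - C (e i) * X) p ∈ ℝ[t]`; since `p`
  is a cubic form with `p(e) = 1` its `t³`-coefficient is `−1 ≠ 0`, and "all zeros real" is
  rendered `Multiset.card (…).roots = 3` (real roots counted with multiplicity).
* Conclusion in the normal form `y·I − A(x)` of Prop. 9.1 with `Aᵢ ↦ −Aᵢ`:
  `p(x) = det (x₀·I + x₁A₁ + x₂A₂ + x₃A₃)` as complex numbers (the right-hand side is the determinant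
  of a hermitian-pencil value, a priori in `ℂ`), `A₁, A₂, A₃` hermitian `3 × 3`
  (`Matrix.IsHermitian`). Only this existence statement is vendored (the "certificate" converse is
  immediate and not needed as a hypothesis).

## References
* [HanselkaKummer2023] C. Hanselka, M. Kummer, Positive Ulrich sheaves, Canad. J. Math. 76 (2024)
  881–914; arXiv:2008.00201: §1 (definitions), Prop. 9.1 (normal form), Cor. 12.10 (p. 24 of the
  arXiv version) and its proof.
* [BuckleyKosir2007] A. Buckley, T. Košir, Determinantal representations of smooth cubic surfaces,
  Geom. Dedicata 125 (2007) 115–140 (the smooth case).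
* W. Nuij, A note on hyperbolic polynomials, Math. Scand. 23 (1968) 69–72; D. Plaumann,
  C. Vinzant, Determinantal representations of hyperbolic plane curves: an elementary approach,
  J. Symbolic Comput. 57 (2013) 48–60 (the closure step of the printed proof).
-/

noncomputable section

open MvPolynomial Matrix

namespace Literature.AlgebraicGeometry.DeterminantalHypersurfaces

/-- **Hanselka–Kummer 2023, Corollary 12.10** (originally Buckley–Košir 2007 for smooth cubic
surfaces): every hyperbolic cubic form in four variables has a definite hermitian determinantal
representation. Rendered in the normal form of ibid. Prop. 9.1 at `e = (1,0,0,0)`: if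
`p ∈ ℝ[x₀,x₁,x₂,x₃]` is homogeneous of degree `3`, `p(1,0,0,0) = 1`, and for every `w ∈ ℝ⁴` the
univariate polynomial `t ↦ p(w − t·(1,0,0,0))` has all its `3` roots real, then there are hermitian
`3 × 3` complex matrices `A₁, A₂, A₃` with `p(x) = det (x₀I + x₁A₁ + x₂A₂ + x₃A₃)` for all real `x`.
Grounds the `N = 3` layer of `Summit.ValiantsHypothesis.ValiantsHypothesis.Theses.PermanentalCones.HyperbolicVPShadow`
(crux workfile `Cruxes/HyperbolicVPShadow/Lines/birth.lean`, stub `stub_hanselkaKummer_cor1210`).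
[cite: HanselkaKummer2023, Cor. 12.10 with Prop. 9.1 (normal form) and §1 (definitions)]
[cite: BuckleyKosir2007, main theorem (smooth case)] -/
def HanselkaKummer2023_cor1210 : Prop :=
  ∀ (p : MvPolynomial (Fin 4) ℝ), p.IsHomogeneous 3 →
    MvPolynomial.eval ![1, 0, 0, 0] p = 1 →
    (∀ w : Fin 4 → ℝ, Multiset.card (MvPolynomial.aeval
        (fun i => Polynomial.C (w i) - Polynomial.C ((![1, 0, 0, 0] : Fin 4 → ℝ) i) * Polynomial.X)
        p).roots = 3) →
    ∃ A₁ A₂ A₃ : Matrix (Fin 3) (Fin 3) ℂ, A₁.IsHermitian ∧ A₂.IsHermitian ∧ A₃.IsHermitian ∧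
      ∀ x : Fin 4 → ℝ, ((MvPolynomial.eval x p : ℝ) : ℂ) =
        ((x 0 : ℂ) • (1 : Matrix (Fin 3) (Fin 3) ℂ) + (x 1 : ℂ) • A₁ + (x 2 : ℂ) • A₂ +
          (x 3 : ℂ) • A₃).det

end Literature.AlgebraicGeometry.DeterminantalHypersurfaces
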